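import Summits.AtomisticToContinuum.Crystallization.Theorems.ChartedZeroExcessLayeredHomCoercivityBDB

/-!
# ChartedZeroExcessLayered · HomCoercivityBD — part C/3: §5.4–§5.6 (the scale-incoherent two-patch; each patch near-homogeneous; the two-atom clean chunk is not) (decomp-a2c lens-2 g24 `HomCoercivityBD.lean` v8 sha256 e49c2223…, lines 645–940,
split at the `## §` boundaries for the gate's 400-line limit; content byte-identical; ONE namespace
`…Theorems.ChartedZeroExcessLayeredHomCoercivityBD` across the parts, linear import chain; critic rows 444/445).
-/

noncomputable section

open scoped BigOperators
open MeasureTheory Set Metric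
open Summit.AtomisticToContinuum.Crystallization.Theorems.ChartedPlanarOrderRigidityDoor
open Summit.AtomisticToContinuum.Crystallization.Theorems.ChartedPlanarOrderDensityDichotomy
open Summit.AtomisticToContinuum.Crystallization.Theorems.ChartedPlanarOrderMesoCut
open Summit.AtomisticToContinuum.Crystallization.Theorems.OverbindingBudgetLiouvilleDictionary
open Literature.MathematicalPhysics.StatisticalMechanics (triangularVec₁ triangularVec₂)
open Literature.Geometry.DiscreteGeometry
open Summit.AtomisticToContinuum.Crystallization.Theorems.ChartedPlanarOrderDoorLayered
  (IsPeriod TwoPeriodic twoPeriodic_layeredHom_of_BD nearHomBD_restrict isCleanChunk_window' atomsIn_subset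
   DoorHomogeneityBD NearHomBulkGapDenseBD hbgBD_of_bulk bulkDoor_of_homBD gap_and_pert_1_50_of_homBD
   DoorPeriodic PeriodicBulkGap PeriodicBulkGapDoor periodicBulkGap_of_bulk periodicBulkGapDoor_of_periodicBulkGap
   bulkDoor_of_periodic gap_and_pert_1_50_of_periodic' doorPeriodic_of_doorHomogeneityBD hbg_pieces_both_of_bulk)
open Summit.AtomisticToContinuum.Crystallization.Theorems.ChartedPlanarOrderDoorLayeredBridge (layeredHom_of_twoPeriodic)

namespace Summit.AtomisticToContinuum.Crystallization.Theorems.ChartedZeroExcessLayeredHomCoercivityBD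

/-! ### §5.4 the scale-incoherent two-patch configuration -/

/-- the centre of patch 2: `(60/√2, 0, 0) ∈ fcc`, `‖c‖ = 30√2 ≈ 42.4`. -/
def cc : E3 := kk • intVec ![60, 0, 0]

/-- patch 1: the ball of radius `10` of `fcc` about the origin (scale `1`). -/
def X₁ : Set E3 := fcc ∩ closedBall 0 10

/-- patch 2: the same ball, shrunk to scale `9/10` and translated to `cc`. -/
def X₂ : Set E3 := (fun x => cc + (9 / 10 : ℝ) • x) '' X₁

/-- **the two-patch configuration** (two clean fcc patches at the two ends `1`, `9/10` of the clean scale window). -/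
def twoPatch : Set E3 := X₁ ∪ X₂

/-- Helper `norm_cc` (lens-2 g24 HomCoercivityBD v8 §5.4–§5.6; statement as displayed). [folklore] -/
theorem norm_cc : ‖cc‖ = 60 * kk := by
  rw [cc, norm_kk_smul_intVec]
  have : (sqNormInt ![(60 : ℤ), 0, 0] : ℝ) = 60 ^ 2 := by simp [sqNormInt]; norm_num
  rw [this, Real.sqrt_sq (by norm_num)]; ring

/-- Helper `le_norm_cc` (lens-2 g24 HomCoercivityBD v8 §5.4–§5.6; statement as displayed). [folklore] -/
theorem le_norm_cc : 42 ≤ ‖cc‖ := by rw [norm_cc]; linarith [seven_tenths_le_kk]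

/-- Helper `cc_mem_fcc` (lens-2 g24 HomCoercivityBD v8 §5.4–§5.6; statement as displayed). [folklore] -/
theorem cc_mem_fcc : cc ∈ fcc := ⟨![60, 0, 0], by decide, rfl⟩

/-- Helper `norm_le_of_mem_X₁` (lens-2 g24 HomCoercivityBD v8 §5.4–§5.6; statement as displayed). [folklore] -/
theorem norm_le_of_mem_X₁ {x : E3} (hx : x ∈ X₁) : ‖x‖ ≤ 10 := by
  have := hx.2; rwa [mem_closedBall, dist_zero_right] at this

/-- Helper `le_norm_of_mem_X₂` (lens-2 g24 HomCoercivityBD v8 §5.4–§5.6; statement as displayed). [folklore] -/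
theorem le_norm_of_mem_X₂ {p : E3} (hp : p ∈ X₂) : 33 ≤ ‖p‖ := by
  obtain ⟨x, hx, rfl⟩ := hp
  have h1 := norm_le_of_mem_X₁ hx
  have h2 : ‖cc‖ ≤ ‖cc + (9 / 10 : ℝ) • x‖ + ‖(9 / 10 : ℝ) • x‖ := by
    calc ‖cc‖ = ‖(cc + (9 / 10 : ℝ) • x) - (9 / 10 : ℝ) • x‖ := by rw [add_sub_cancel_right]
      _ ≤ _ := norm_sub_le _ _
  rw [norm_smul, Real.norm_of_nonneg (by norm_num)] at h2
  linarith [le_norm_cc]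

/-- Helper `le_norm_sub_cc_of_mem_X₁` (lens-2 g24 HomCoercivityBD v8 §5.4–§5.6; statement as displayed). [folklore] -/
theorem le_norm_sub_cc_of_mem_X₁ {x : E3} (hx : x ∈ X₁) : 32 ≤ ‖x - cc‖ := by
  have h1 := norm_le_of_mem_X₁ hx
  have h2 : ‖cc‖ ≤ ‖x - cc‖ + ‖x‖ := by
    calc ‖cc‖ = ‖x - (x - cc)‖ := by rw [sub_sub_cancel]
      _ ≤ ‖x‖ + ‖x - cc‖ := norm_sub_le _ _
      _ = _ := add_comm _ _
  linarith [le_norm_cc]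

/-- Helper `zero_mem_X₁` (lens-2 g24 HomCoercivityBD v8 §5.4–§5.6; statement as displayed). [folklore] -/
theorem zero_mem_X₁ : (0 : E3) ∈ X₁ := ⟨zero_mem_fcc, by simp⟩

/-- Helper `cc_mem_X₂` (lens-2 g24 HomCoercivityBD v8 §5.4–§5.6; statement as displayed). [folklore] -/
theorem cc_mem_X₂ : cc ∈ X₂ := ⟨0, zero_mem_X₁, by simp⟩

/-- **the two-patch configuration is `9/10`-separated.** -/
theorem isSep_twoPatch : IsSep (9 / 10) twoPatch := by
  intro x hx y hy hxy
  rcases hx with hx | hx <;> rcases hy with hy | hy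
  · linarith [one_le_dist_of_mem_fcc hx.1 hy.1 hxy]
  · rw [dist_eq_norm]
    have : ‖y‖ ≤ ‖x - y‖ + ‖x‖ := by
      calc ‖y‖ = ‖x - (x - y)‖ := by rw [sub_sub_cancel]
        _ ≤ ‖x‖ + ‖x - y‖ := norm_sub_le _ _
        _ = _ := add_comm _ _
    linarith [norm_le_of_mem_X₁ hx, le_norm_of_mem_X₂ hy]
  · rw [dist_eq_norm]
    have : ‖x‖ ≤ ‖x - y‖ + ‖y‖ := norm_le_norm_sub_add x y
    linarith [norm_le_of_mem_X₁ hy, le_norm_of_mem_X₂ hx]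
  · obtain ⟨a, ha, rfl⟩ := hx
    obtain ⟨b, hb, rfl⟩ := hy
    have hab : a ≠ b := by rintro rfl; exact hxy rfl
    have h1 := one_le_dist_of_mem_fcc ha.1 hb.1 hab
    rw [dist_eq_norm] at h1 ⊢
    rw [add_sub_add_left_eq_sub, ← smul_sub, norm_smul, Real.norm_of_nonneg (by norm_num)]
    linarith

/-- the origin is a clean atom of the two-patch configuration (scale `1`, frame `id`, fcc pattern, exact). -/
theorem clean_zero : IsTwoShellGoodSet (1 / 16) (9 / 10) 1 twoPatch 0 := by
  refine ⟨1, by norm_num, le_rfl, LinearIsometry.id, fccTwoShellPattern, id, Or.inl rfl, fun v hv => ⟨?_, ?_⟩,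
    Set.injOn_id _, fun y hy hy0 hyd => ?_⟩
  · refine Or.inl ⟨mem_fcc_of_mem_pattern hv, ?_⟩
    simp only [id, mem_closedBall, dist_zero_right]; linarith [norm_le_of_mem_pattern hv]
  · simp
  · have hy1 : y ∈ fcc := by
      rcases hy with hy | hy
      · exact hy.1
      · exfalso
        have := le_norm_of_mem_X₂ hy
        rw [dist_zero_right] at hyd; linarith
    rw [dist_zero_right] at hyd
    exact ⟨y, mem_pattern_of_mem_fcc hy1 hy0 (by linarith), rfl⟩

/-- the centre of patch 2 is a clean atom of the two-patch configuration (scale `9/10`, frame `id`, fcc pattern, exact). -/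
theorem clean_cc : IsTwoShellGoodSet (1 / 16) (9 / 10) 1 twoPatch cc := by
  refine ⟨9 / 10, le_rfl, by norm_num, LinearIsometry.id, fccTwoShellPattern, fun v => cc + (9 / 10 : ℝ) • v, Or.inl rfl,
    fun v hv => ⟨?_, ?_⟩, fun v _ v' _ h => ?_, fun y hy hyc hyd => ?_⟩
  · refine Or.inr ⟨v, ⟨mem_fcc_of_mem_pattern hv, ?_⟩, rfl⟩
    rw [mem_closedBall, dist_zero_right]; linarith [norm_le_of_mem_pattern hv]
  · simp only [LinearIsometry.coe_id, id, dist_self]; norm_num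
  · have h' : (9 / 10 : ℝ) • v = (9 / 10 : ℝ) • v' := add_left_cancel h
    exact smul_right_injective E3 (by norm_num : (9 / 10 : ℝ) ≠ 0) h'
  · have hy2 : y ∈ X₂ := by
      rcases hy with hy | hy
      · exfalso
        have := le_norm_sub_cc_of_mem_X₁ hy
        rw [dist_eq_norm] at hyd; linarith
      · exact hy
    obtain ⟨x, hx, rfl⟩ := hy2
    have hx0 : x ≠ 0 := by rintro rfl; exact hyc (by simp)
    have hxn : ‖x‖ ≤ 3 / 2 := by
      rw [dist_eq_norm, add_sub_cancel_left, norm_smul, Real.norm_of_nonneg (by norm_num)] at hyd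
      linarith
    exact ⟨x, mem_pattern_of_mem_fcc hx.1 hx0 hxn, rfl⟩

/-- `{0, cc}` is a clean chunk of the two-patch configuration. -/
theorem isCleanChunk_twoPatch : IsCleanChunk twoPatch {0, cc} := by
  refine ⟨?_, (Set.finite_singleton cc).insert 0, ?_⟩
  · intro x hx
    rcases hx with rfl | hx
    · exact Or.inl zero_mem_X₁
    · rw [Set.mem_singleton_iff] at hx; subst hx; exact Or.inr cc_mem_X₂
  · intro x hx
    rcases hx with rfl | hx
    · exact clean_zero
    · rw [Set.mem_singleton_iff] at hx; subst hx; exact clean_cc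

/-! ### §5.5 each patch ALONE is near-homogeneous in the bounded-distortion currency (exactly, `τ = 0` allowed) -/

/-- Helper `norm_chart₁_le` (lens-2 g24 HomCoercivityBD v8 §5.4–§5.6; statement as displayed). [folklore] -/
theorem norm_chart₁_le : ‖(chart₁ : E3 →L[ℝ] E3)‖ ≤ 2 := norm_mkChart_le _ norm_chartLin_le _
/-- Helper `norm_chart₁_symm_le` (lens-2 g24 HomCoercivityBD v8 §5.4–§5.6; statement as displayed). [folklore] -/
theorem norm_chart₁_symm_le : ‖(chart₁.symm : E3 →L[ℝ] E3)‖ ≤ 2 := norm_mkChart_symm_le _ _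
/-- Helper `norm_chart₂_le` (lens-2 g24 HomCoercivityBD v8 §5.4–§5.6; statement as displayed). [folklore] -/
theorem norm_chart₂_le : ‖(chart₂ : E3 →L[ℝ] E3)‖ ≤ 2 := norm_mkChart_le _ norm_chartLin'_le _
/-- Helper `norm_chart₂_symm_le` (lens-2 g24 HomCoercivityBD v8 §5.4–§5.6; statement as displayed). [folklore] -/
theorem norm_chart₂_symm_le : ‖(chart₂.symm : E3 →L[ℝ] E3)‖ ≤ 2 := norm_mkChart_symm_le _ _

/-- the fcc lattice IS the layered structure of `chart₁` (both inclusions, §5.3). -/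
theorem layered₁_eq_fcc : LayeredHom (chart₁ : E3 →L[ℝ] E3) w₁ = fcc :=
  Set.Subset.antisymm layered₁_subset_fcc fcc_subset_layered₁

/-- **NON-VACUITY of bridge B's / HBG″♭'s hypotheses** (§3c): the fcc lattice is two-periodic with exact periods of length `≤ 2`
(tree `twoPeriodic_layeredHom_of_BD` on `chart₁`), rooted and `1`-separated. -/
theorem twoPeriodic_fcc : TwoPeriodic 2 fcc := by
  rw [← layered₁_eq_fcc]; exact twoPeriodic_layeredHom_of_BD chart₁ norm_chart₁_le w₁

/-- Helper `isSep_fcc` (lens-2 g24 HomCoercivityBD v8 §5.4–§5.6; statement as displayed). [folklore] -/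
theorem isSep_fcc : IsSep 1 fcc := fun _ hx _ hy hxy => one_le_dist_of_mem_fcc hx hy hxy

/-- Helper `periodicChart_hyps` (lens-2 g24 HomCoercivityBD v8 §5.4–§5.6; statement as displayed). [folklore] -/
theorem periodicChart_hyps : ∃ S : Set E3, (0 : E3) ∈ S ∧ IsSep 1 S ∧ TwoPeriodic 2 S :=
  ⟨fcc, zero_mem_fcc, isSep_fcc, twoPeriodic_fcc⟩

/-- **patch 1 alone is `(2, τ, r)`-near-homogeneous** (`0 ≤ τ`, `r ≤ 9`): its reference structure is `fcc` itself. -/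
theorem nearHomBD_patch₁ {τ r : ℝ} (hτ : 0 ≤ τ) (hr : r ≤ 9) : NearHomBD 2 τ r twoPatch {0} := by
  refine ⟨chart₁, norm_chart₁_le, norm_chart₁_symm_le, w₁, id, Set.injOn_id _,
    fun x hx => ?_, fun x hx => ⟨fun p hp hpr => ?_, fun q hq hqr => ?_⟩⟩
  · rw [Set.mem_singleton_iff] at hx; subst hx
    exact fcc_subset_layered₁ zero_mem_fcc
  · rw [Set.mem_singleton_iff] at hx; subst hx
    have hp1 : p ∈ fcc := by
      rcases hp with hp | hp
      · exact hp.1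
      · exfalso; have := le_norm_of_mem_X₂ hp; rw [dist_zero_right] at hpr; linarith
    exact ⟨p, fcc_subset_layered₁ hp1, by simp [hτ]⟩
  · rw [Set.mem_singleton_iff] at hx; subst hx
    have hq1 : q ∈ X₁ := ⟨layered₁_subset_fcc hq, by
      rw [mem_closedBall]; simp only [id] at hqr; linarith⟩
    exact ⟨q, Or.inl hq1, by simp [hτ]⟩

/-- the layer offsets of the reference structure of patch 2. -/
def w₂ (m : ℤ) : E3 := cc + (9 / 10 : ℝ) • w₁ m

/-- Helper `layerPoint₂` (lens-2 g24 HomCoercivityBD v8 §5.4–§5.6; statement as displayed). [folklore] -/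
theorem layerPoint₂ (m i j : ℤ) :
    (chart₂ : E3 →L[ℝ] E3) (((i : ℝ) • triangularVec₁ 1) + ((j : ℝ) • triangularVec₂ 1)) + w₂ m =
      cc + (9 / 10 : ℝ) • (chartLin (((i : ℝ) • triangularVec₁ 1) + ((j : ℝ) • triangularVec₂ 1)) + w₁ m) := by
  rw [show (chart₂ : E3 →L[ℝ] E3) (((i : ℝ) • triangularVec₁ 1) + ((j : ℝ) • triangularVec₂ 1)) =
    chartLin' (((i : ℝ) • triangularVec₁ 1) + ((j : ℝ) • triangularVec₂ 1)) from rfl, chartLin'_apply, w₂, smul_add]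
  abel

/-- Helper `mem_layered₂_of_mem_fcc` (lens-2 g24 HomCoercivityBD v8 §5.4–§5.6; statement as displayed). [folklore] -/
theorem mem_layered₂_of_mem_fcc {x : E3} (hx : x ∈ fcc) : cc + (9 / 10 : ℝ) • x ∈ LayeredHom (chart₂ : E3 →L[ℝ] E3) w₂ := by
  obtain ⟨m, i, j, h⟩ := fcc_subset_layered₁ hx
  refine ⟨m, i, j, ?_⟩
  rw [layerPoint₂, h]; rfl

/-- Helper `exists_fcc_of_mem_layered₂` (lens-2 g24 HomCoercivityBD v8 §5.4–§5.6; statement as displayed). [folklore] -/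
theorem exists_fcc_of_mem_layered₂ {q : E3} (hq : q ∈ LayeredHom (chart₂ : E3 →L[ℝ] E3) w₂) :
    ∃ z ∈ fcc, q = cc + (9 / 10 : ℝ) • z := by
  obtain ⟨m, i, j, rfl⟩ := hq
  exact ⟨_, layered₁_subset_fcc ⟨m, i, j, rfl⟩, by rw [layerPoint₂]; rfl⟩

/-- **patch 2 alone is `(2, τ, r)`-near-homogeneous** (`0 ≤ τ`, `r ≤ 9`): its reference structure is `cc + (9/10)·fcc`. -/
theorem nearHomBD_patch₂ {τ r : ℝ} (hτ : 0 ≤ τ) (hr : r ≤ 9) : NearHomBD 2 τ r twoPatch {cc} := by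
  refine ⟨chart₂, norm_chart₂_le, norm_chart₂_symm_le, w₂, id, Set.injOn_id _,
    fun x hx => ?_, fun x hx => ⟨fun p hp hpr => ?_, fun q hq hqr => ?_⟩⟩
  · rw [Set.mem_singleton_iff] at hx; subst hx
    have := mem_layered₂_of_mem_fcc zero_mem_fcc
    rwa [smul_zero, add_zero] at this
  · rw [Set.mem_singleton_iff] at hx; subst hx
    have hp2 : p ∈ X₂ := by
      rcases hp with hp | hp
      · exfalso; have := le_norm_sub_cc_of_mem_X₁ hp; rw [dist_eq_norm] at hpr; linarith
      · exact hp
    obtain ⟨z, hz, rfl⟩ := hp2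
    exact ⟨_, mem_layered₂_of_mem_fcc hz.1, by simp [hτ]⟩
  · rw [Set.mem_singleton_iff] at hx; subst hx
    obtain ⟨z, hz, rfl⟩ := exists_fcc_of_mem_layered₂ hq
    have hz1 : z ∈ X₁ := ⟨hz, by
      rw [mem_closedBall, dist_zero_right]
      simp only [id] at hqr
      rw [dist_eq_norm, add_sub_cancel_left, norm_smul, Real.norm_of_nonneg (by norm_num)] at hqr
      linarith⟩
    exact ⟨_, Or.inr ⟨z, hz1, rfl⟩, by simp [hτ]⟩

/-! ### §5.6 … but the two-atom clean chunk `{0, cc}` is NOT: one chart cannot serve both scales -/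

/-- **(w2) THE SCALE-INCOHERENT TWO-PATCH WITNESS.**  For `τ ≤ 1/50` and `r ≥ 2` the clean chunk `{0, cc}` of the `9/10`-separated
configuration `twoPatch` is not `(2, τ, r)`-near-homogeneous: the ONE model vector `L t₁` (`1/2 ≤ ‖L t₁‖ ≤ 2`) would have to be `τ`-close
to an fcc vector `p` (environment of `0`, scale `1`) AND to `(9/10)·x` with `x` an fcc vector (environment of `cc`, scale `9/10`); but
`‖p − (9/10)x‖ ≥ 1/10` for all non-zero fcc vectors `p, x` with `‖x‖ ≤ 3` (`p = x`: `= ‖x‖/10 ≥ 1/10`; `p ≠ x`: `≥ 1 − ‖x‖/10`). -/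
theorem not_nearHomBD_twoPatch {τ r : ℝ} (hτ' : τ ≤ 1 / 50) (hr : 2 ≤ r) :
    ¬ NearHomBD 2 τ r twoPatch {0, cc} := by
  rintro ⟨L, hL, hL', w, Ψ, -, hmaps, henv⟩
  set v : E3 := (L : E3 →L[ℝ] E3) (triangularVec₁ 1) with hv
  have hvle : ‖v‖ ≤ 2 :=
    calc ‖v‖ ≤ ‖(L : E3 →L[ℝ] E3)‖ * ‖triangularVec₁ 1‖ := ContinuousLinearMap.le_opNorm _ _
      _ ≤ 2 * 1 := by rw [norm_triangularVec₁_one]; exact mul_le_mul_of_nonneg_right hL zero_le_one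
      _ = 2 := by norm_num
  have hvge : 1 ≤ 2 * ‖v‖ := by
    have h1 : ‖triangularVec₁ 1‖ ≤ 2 * ‖v‖ :=
      calc ‖triangularVec₁ 1‖ = ‖(L.symm : E3 →L[ℝ] E3) ((L : E3 →L[ℝ] E3) (triangularVec₁ 1))‖ := by simp
        _ ≤ ‖(L.symm : E3 →L[ℝ] E3)‖ * ‖(L : E3 →L[ℝ] E3) (triangularVec₁ 1)‖ := ContinuousLinearMap.le_opNorm _ _
        _ ≤ 2 * ‖v‖ := mul_le_mul_of_nonneg_right hL' (norm_nonneg _)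
    rwa [norm_triangularVec₁_one] at h1
  -- the model vector `v` is `τ`-realised in the environment of every atom of the chunk
  have key : ∀ z ∈ ({0, cc} : Set E3), ∃ p ∈ twoPatch, dist (p - z) v ≤ τ := by
    intro z hz
    obtain ⟨m, i, j, hΨ⟩ := hmaps hz
    obtain ⟨-, h2⟩ := henv z hz
    set q : E3 := (L : E3 →L[ℝ] E3) (((i + 1 : ℤ) : ℝ) • triangularVec₁ 1 + (j : ℝ) • triangularVec₂ 1) + w m with hq
    have hqH : q ∈ LayeredHom (L : E3 →L[ℝ] E3) w := ⟨m, i + 1, j, rfl⟩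
    have hdiff : q - Ψ z = v := by
      rw [hq, hΨ, add_sub_add_right_eq_sub, ← map_sub, hv]
      congr 1
      push_cast
      rw [add_smul, one_smul]
      abel
    have hqx : dist q (Ψ z) ≤ r := by rw [dist_eq_norm, hdiff]; linarith
    obtain ⟨p, hp, hpq⟩ := h2 q hqH hqx
    exact ⟨p, hp, by rwa [hdiff] at hpq⟩
  obtain ⟨p, hp, hpv⟩ := key 0 (by simp)
  obtain ⟨p', hp', hp'v⟩ := key cc (by simp)
  rw [sub_zero] at hpv
  -- `p` lies in patch 1
  have hp1 : p ∈ fcc := by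
    rcases hp with hp | hp
    · exact hp.1
    · exfalso
      have h33 := le_norm_of_mem_X₂ hp
      have h3 : ‖p‖ ≤ dist p v + ‖v‖ := by rw [dist_eq_norm]; exact norm_le_norm_sub_add p v
      linarith
  -- `p'` lies in patch 2
  have hp2 : p' ∈ X₂ := by
    rcases hp' with hp' | hp'
    · exfalso
      have h32 := le_norm_sub_cc_of_mem_X₁ hp'
      have h3 : ‖p' - cc‖ ≤ dist (p' - cc) v + ‖v‖ := by rw [dist_eq_norm]; exact norm_le_norm_sub_add _ v
      linarith
    · exact hp'
  obtain ⟨x, hx, rfl⟩ := hp2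
  rw [add_sub_cancel_left] at hp'v
  have hpx : ‖p - (9 / 10 : ℝ) • x‖ ≤ 2 * τ :=
    calc ‖p - (9 / 10 : ℝ) • x‖ = dist p ((9 / 10 : ℝ) • x) := (dist_eq_norm _ _).symm
      _ ≤ dist p v + dist ((9 / 10 : ℝ) • x) v := dist_triangle_right _ _ _
      _ ≤ τ + τ := add_le_add hpv hp'v
      _ = 2 * τ := by ring
  have hxn : ‖x‖ ≤ 3 := by
    have h1 : ‖(9 / 10 : ℝ) • x‖ ≤ dist ((9 / 10 : ℝ) • x) v + ‖v‖ := by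
      rw [dist_eq_norm]; exact norm_le_norm_sub_add _ v
    rw [norm_smul, Real.norm_of_nonneg (by norm_num)] at h1
    linarith
  have hx0 : x ≠ 0 := by
    rintro rfl
    rw [smul_zero, dist_comm, dist_zero_right] at hp'v
    linarith
  by_cases hpx' : p = x
  · subst hpx'
    have h1 := one_le_norm_of_mem_fcc hp1 hx0
    have e : p - (9 / 10 : ℝ) • p = (1 / 10 : ℝ) • p := by
      rw [show (1 / 10 : ℝ) = 1 - 9 / 10 by norm_num, sub_smul, one_smul]
    rw [e, norm_smul, Real.norm_of_nonneg (by norm_num)] at hpx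
    linarith
  · have h1 := one_le_dist_of_mem_fcc hp1 hx.1 hpx'
    rw [dist_eq_norm] at h1
    have e : p - x = (p - (9 / 10 : ℝ) • x) - (1 / 10 : ℝ) • x := by
      rw [show (1 / 10 : ℝ) = 1 - 9 / 10 by norm_num, sub_smul, one_smul]; abel
    have h2 : ‖p - x‖ ≤ ‖p - (9 / 10 : ℝ) • x‖ + ‖(1 / 10 : ℝ) • x‖ := by rw [e]; exact norm_sub_le _ _
    rw [norm_smul, Real.norm_of_nonneg (by norm_num)] at h2
    linarith

/-- **`NearHomBD 2` is a GENUINE restriction on clean chunks** (critic row 399 (5): «HBG♮(u)_BD ↚ BULK-free tautology»): a `9/10`-separated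
configuration and a clean two-atom chunk each of whose atoms is near-homogeneous on its own, while the chunk is not — so the homogeneity
hypothesis of HBG♮(u)[BD] cannot be discharged atom-by-atom and HBG♮(u)[BD] is NOT «BULK with a vacuous extra hypothesis». -/
theorem nearHomBD_genuine_restriction {τ r : ℝ} (hτ : 0 ≤ τ) (hτ' : τ ≤ 1 / 50) (hr : 2 ≤ r) (hr' : r ≤ 9) :
    ∃ S Q : Set E3, IsSep (9 / 10) S ∧ IsCleanChunk S Q ∧ (∀ x ∈ Q, NearHomBD 2 τ r S {x}) ∧ ¬ NearHomBD 2 τ r S Q :=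
  ⟨twoPatch, {0, cc}, isSep_twoPatch, isCleanChunk_twoPatch, fun x hx => by
    rcases hx with rfl | hx
    · exact nearHomBD_patch₁ hτ hr'
    · rw [Set.mem_singleton_iff] at hx; subst hx; exact nearHomBD_patch₂ hτ hr', not_nearHomBD_twoPatch hτ' hr⟩

end Summit.AtomisticToContinuum.Crystallization.Theorems.ChartedZeroExcessLayeredHomCoercivityBD

end
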